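import Mathlib
import HarnessLib
import Summits.CriticalPhenomena.PercolationContinuityZ3.Theorems.PercNearOneGluingNoHeavyLowerTailKnQuestion8AntitheticCubeCharge

/-!
# `NoHeavyLowerTail` (crux stmt-CriticalPhenomena-4575), antithetic vdBHK programme: THE LEVEL LEMMA FOR ANY NUMBER OF ROOT LEAVES

Support file (seat `prim-ineq-gen-7` gen 40; `--supports stmt-CriticalPhenomena-4575`).  Nothing is asserted about the crux; no `sorry`,
no definitions.  Memo: run/shared/lean/prim/prim-ineq-gen-7/FINDING-LEVINF-g40.md §1–§3 (THEOREM LEVEL∞).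

CONTEXT.  THEOREM RES (gen 39, `AntitheticRootEdge.res_induction`) makes the per-tree inequality `(***)` hereditary under root-edge
subdivision of a leg against a 'rest' `T_rest` as soon as the finite LEVEL LEMMA of the rest holds.  For the rest '`s` root leaves' the
level functional lives on the Boolean lattice `2^α` (`|α| = s`): sixteen upper families — for each of the four up-sets `a, a′, b, b′` the
memberships at the bowtie levels `B′, T′, τ′, β′`, with `B′ ⊆ T′ ∩ τ′`, `β′ ⊆ T′ ∩ τ′` — and
`Λ = Σ_y [crossed products at y + c_B(y) + c_T(y) + c_new(y) − c_old(y)]`, routes read at the antipode `yᶜ` (memo §1; OPEN-RES-g39 §1(iii)).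
CONJECTURE LEVEL^{B_s} (g39, verified for `s ≤ 4`) asserted `Λ ≥ 0` for every `s`.

THEOREM LEVEL∞ (memo §2).  `Λ ≥ 0` for all `s`.  PROOF: `2Λ = Σ_y [λ(y) + λ(yᶜ)]`; the ∀ aT0 aU0 aB0 : Bool, (aB0 = true → aT0 = true) → (aB0 = true → aU0 = true) →
      ∀ aE0 : Bool, (aE0 = true → aT0 = true) → (aE0 = true → aU0 = true) →
      ∀ pT0 pU0 pB0 : Bool, (pB0 = true → pT0 = true) → (pB0 = true → pU0 = true) →
      ∀ pE0 : Bool, (pE0 = true → pT0 = true) → (pE0 = true → pU0 = true) →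
      ∀ bT0 bU0 bB0 : Bool, (bB0 = true → bT0 = true) → (bB0 = true → bU0 = true) →
      ∀ bE0 : Bool, (bE0 = true → bT0 = true) → (bE0 = true → bU0 = true) →
      ∀ qT0 qU0 qB0 : Bool, (qB0 = true → qT0 = true) → (qB0 = true → qU0 = true) →
      ∀ qE0 : Bool, (qE0 = true → qT0 = true) → (qE0 = true → qU0 = true) →
      ∀ aT1 aU1 aB1 : Bool, (aB1 = true → aT1 = true) → (aB1 = true → aU1 = true) →
      ∀ aE1 : Bool, (aE1 = true → aT1 = true) → (aE1 = true → aU1 = true) →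
      ∀ pT1 pU1 pB1 : Bool, (pB1 = true → pT1 = true) → (pB1 = true → pU1 = true) →
      ∀ pE1 : Bool, (pE1 = true → pT1 = true) → (pE1 = true → pU1 = true) →
      ∀ bT1 bU1 bB1 : Bool, (bB1 = true → bT1 = true) → (bB1 = true → bU1 = true) →
      ∀ bE1 : Bool, (bE1 = true → bT1 = true) → (bE1 = true → bU1 = true) →
      ∀ qT1 qU1 qB1 : Bool, (qB1 = true → qT1 = true) → (qB1 = true → qU1 = true) →
      ∀ qE1 : Bool, (qE1 = true → qT1 = true) → (qE1 = true → qU1 = true) →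
      0 ≤ ((if aB0 then (1:ℤ) else 0) - (if pT1 then (1:ℤ) else 0)) * ((if bB0 then (1:ℤ) else 0) - (if qT1 then (1:ℤ) else 0)) + ((if aT0 then (1:ℤ) else 0) - (if pB1 then (1:ℤ) else 0)) * ((if bT0 then (1:ℤ) else 0) - (if qB1 then (1:ℤ) else 0))
      + (if ((aT1 ∧ ¬ pB0 ∧ ¬ bB0 ∧ qT1) ∨ (¬ aB0 ∧ pT1 ∧ bT1 ∧ ¬ qB0)) then (1:ℤ) else 0)
      + (if (((aB1 ∨ aE1) ∧ ¬ pT0 ∧ ¬ bT0 ∧ (qB1 ∨ qE1)) ∨ (¬ aT0 ∧ (pB1 ∨ pE1) ∧ (bB1 ∨ bE1) ∧ ¬ qT0)) then (1:ℤ) else 0)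
      + (if ((aB1 ∧ ¬ pU0 ∧ ¬ bU0 ∧ qB1) ∨ (¬ aU0 ∧ pB1 ∧ bB1 ∧ ¬ qU0)) then (1:ℤ) else 0)
      - (if ((aE1 ∧ ¬ pU0 ∧ ¬ bU0 ∧ qE1) ∨ (¬ aU0 ∧ pE1 ∧ bE1 ∧ ¬ qU0)) then (1:ℤ) else 0)
      + (((if aB1 then (1:ℤ) else 0) - (if pT0 then (1:ℤ) else 0)) * ((if bB1 then (1:ℤ) else 0) - (if qT0 then (1:ℤ) else 0)) + ((if aT1 then (1:ℤ) else 0) - (if pB0 then (1:ℤ) else 0)) * ((if bT1 then (1:ℤ) else 0) - (if qB0 then (1:ℤ) else 0))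
      + (if ((aT0 ∧ ¬ pB1 ∧ ¬ bB1 ∧ qT0) ∨ (¬ aB1 ∧ pT0 ∧ bT0 ∧ ¬ qB1)) then (1:ℤ) else 0)
      + (if (((aB0 ∨ aE0) ∧ ¬ pT1 ∧ ¬ bT1 ∧ (qB0 ∨ qE0)) ∨ (¬ aT1 ∧ (pB0 ∨ pE0) ∧ (bB0 ∨ bE0) ∧ ¬ qT1)) then (1:ℤ) else 0)
      + (if ((aB0 ∧ ¬ pU1 ∧ ¬ bU1 ∧ qB0) ∨ (¬ aU1 ∧ pB0 ∧ bB0 ∧ ¬ qU1)) then (1:ℤ) else 0)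
      - (if ((aE0 ∧ ¬ pU1 ∧ ¬ bU1 ∧ qE0) ∨ (¬ aU1 ∧ pE0 ∧ bE0 ∧ ¬ qU1)) then (1:ℤ) else 0))
      - (((if (bB0 ∧ ¬ qB1) then (1:ℤ) else 0) - (if (bB1 ∧ ¬ qB0) then (1:ℤ) else 0)) * ((if (¬ aB1 ∧ pB0) then (1:ℤ) else 0) - (if (¬ aB0 ∧ pB1) then (1:ℤ) else 0))
      + ((if (qB0 ∧ ¬ bB1) then (1:ℤ) else 0) - (if (qB1 ∧ ¬ bB0) then (1:ℤ) else 0)) * ((if (¬ pB1 ∧ aB0) then (1:ℤ) else 0) - (if (¬ pB0 ∧ aB1) then (1:ℤ) else 0))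
      + ((if (bT0 ∧ ¬ qT1) then (1:ℤ) else 0) - (if (bT1 ∧ ¬ qT0) then (1:ℤ) else 0)) * ((if (¬ aT1 ∧ pT0) then (1:ℤ) else 0) - (if (¬ aT0 ∧ pT1) then (1:ℤ) else 0))
      + ((if (qT0 ∧ ¬ bT1) then (1:ℤ) else 0) - (if (qT1 ∧ ¬ bT0) then (1:ℤ) else 0)) * ((if (¬ pT1 ∧ aT0) then (1:ℤ) else 0) - (if (¬ pT0 ∧ aT1) then (1:ℤ) else 0))) LEMMA bounds `λ(y) + λ(yᶜ)` below by the
summand `κ(y)` of four KLEITMAN differences — the two Kleitman steps of the cube-charge inequality for each of the two 'straight slices'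
`{B′} × 2^α`, `{T′} × 2^α` (partner read at the SAME level: `Ã⁺_ℓ = {y ∈ a_ℓ, yᶜ ∉ a′_ℓ}`, `B̃⁻_ℓ = {y ∉ b_ℓ, yᶜ ∈ b′_ℓ}`, …) — and
`Σ_y κ(y) ≥ 0` by Kleitman's lemma on `2^α` (`AntitheticCube.card_inter_le_card_compls_inter`).  The pair lemma is a decidable sentence in
32 Booleans (5,764,801 admissible cases, 478,346 of them tight); it is certified three ways outside Lean (exact integer evaluation of all cases
by two independent programs, and `cadical` UNSAT on the negation, memo §3) and exceeds the default `decide` budget, so it enters here as the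
hypothesis `hpair` — exactly as the finite level lemmas of THEOREM SP (g33) enter `AntitheticPotential`.
* `AntitheticLevelCube.kleitman_column` — one Kleitman column: for `u` increasing and `d` decreasing on `2^α`,
  `0 ≤ Σ_y (u y − u yᶜ)(d yᶜ − d y)` (`= 2(#(U ∩ Dᶜˢ) − #(U ∩ D))`);
* `AntitheticLevelCube.sum_nonneg_of_pair` — the summation skeleton `(∀ y, K y ≤ L y + L yᶜ) → 0 ≤ Σ K → 0 ≤ Σ L`;
* `AntitheticLevelCube.level_cube_charge` — THEOREM LEVEL∞ from the pair lemma: `Λ ≥ 0` on `2^α` for every finite `α`.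
With THEOREM RES and the cube-charge base (`AntitheticCube.cube_charge`, stars) this gives `(***)` for `P_m ∨ s·P₁` for ALL `m, s`
(a pendant path plus any number of pendant edges at one cycle vertex; memo §4).
-/

namespace Summit.CriticalPhenomena.PercolationContinuityZ3.Theorems

open Finset
open scoped FinsetFamily

namespace AntitheticLevelCube

variable {α : Type*} [DecidableEq α] [Fintype α]

/-- Product of two indicators is the indicator of the conjunction. -/
private theorem ite_mul_ite (P Q : Prop) [Decidable P] [Decidable Q] :
    (if P then (1:ℤ) else 0) * (if Q then (1:ℤ) else 0) = if (P ∧ Q) then (1:ℤ) else 0 := by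
  by_cases hP : P <;> by_cases hQ : Q <;> simp [hP, hQ]

omit [DecidableEq α] in
/-- `Σ_y [P y] = #(filter P)` over the whole power set, in `ℤ`. -/
private theorem sum_ite_eq_card (P : Finset α → Prop) [DecidablePred P] :
    ∑ y : Finset α, (if P y then (1:ℤ) else 0) = ((univ.filter P).card : ℤ) := by
  rw [Finset.sum_boole]

/-- ONE KLEITMAN COLUMN.  For `u` increasing and `d` decreasing on the Boolean lattice `2^α`:
`0 ≤ Σ_y (u y − u yᶜ)(d yᶜ − d y)`; indeed the sum equals `2 (#(U ∩ Dᶜˢ) − #(U ∩ D))` for `U = {u}`, `D = {d}`, and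
`#(U ∩ D) ≤ #(Uᶜˢ ∩ D) = #(U ∩ Dᶜˢ)` is Kleitman's lemma (`AntitheticCube.card_inter_le_card_compls_inter`). [this work; memo §2] -/
theorem kleitman_column (u d : Finset α → Prop) [DecidablePred u] [DecidablePred d]
    (hu : ∀ y y' : Finset α, y ⊆ y' → u y → u y') (hd : ∀ y y' : Finset α, y ⊆ y' → d y' → d y) :
    0 ≤ ∑ y : Finset α, ((if u y then (1:ℤ) else 0) - (if u yᶜ then (1:ℤ) else 0)) *
        ((if d yᶜ then (1:ℤ) else 0) - (if d y then (1:ℤ) else 0)) := by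
  set U : Finset (Finset α) := univ.filter u with hU_def
  set D : Finset (Finset α) := univ.filter d with hD_def
  have mU : ∀ y, y ∈ U ↔ u y := fun y => by simp [hU_def]
  have mD : ∀ y, y ∈ D ↔ d y := fun y => by simp [hD_def]
  have hU : IsUpperSet (U : Set (Finset α)) := by
    intro y y' hyy hy; rw [Finset.mem_coe, mU] at hy ⊢; exact hu y y' hyy hy
  have hD : IsLowerSet (D : Set (Finset α)) := by
    intro y y' hyy hy; rw [Finset.mem_coe, mD] at hy ⊢; exact hd y' y hyy hy
  have hK := AntitheticCube.card_inter_le_card_compls_inter U D hU hD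
  rw [AntitheticCube.card_compls_inter] at hK
  -- the four indicator sums as cardinalities
  have e1 : ∑ y : Finset α, (if u y then (1:ℤ) else 0) * (if d y then (1:ℤ) else 0) = ((U ∩ D).card : ℤ) := by
    simp_rw [ite_mul_ite]; rw [sum_ite_eq_card]; congr 1
    congr 1; ext y; simp [mU, mD, Finset.mem_filter, Finset.mem_inter]
  have e2 : ∑ y : Finset α, (if u y then (1:ℤ) else 0) * (if d yᶜ then (1:ℤ) else 0) = ((U ∩ Dᶜˢ).card : ℤ) := by
    simp_rw [ite_mul_ite]; rw [sum_ite_eq_card]; congr 1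
    congr 1; ext y; simp [mU, mD, Finset.mem_filter, Finset.mem_inter, Finset.mem_compls]
  have e3 : ∑ y : Finset α, (if u yᶜ then (1:ℤ) else 0) * (if d y then (1:ℤ) else 0) = ((Uᶜˢ ∩ D).card : ℤ) := by
    simp_rw [ite_mul_ite]; rw [sum_ite_eq_card]; congr 1
    congr 1; ext y; simp [mU, mD, Finset.mem_filter, Finset.mem_inter, Finset.mem_compls]
  have e4 : ∑ y : Finset α, (if u yᶜ then (1:ℤ) else 0) * (if d yᶜ then (1:ℤ) else 0) = ((Uᶜˢ ∩ Dᶜˢ).card : ℤ) := by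
    simp_rw [ite_mul_ite]; rw [sum_ite_eq_card]; congr 1
    congr 1; ext y; simp [mU, mD, Finset.mem_filter, Finset.mem_inter, Finset.mem_compls]
  have c3 : (Uᶜˢ ∩ D).card = (U ∩ Dᶜˢ).card := AntitheticCube.card_compls_inter U D
  have c4 : (Uᶜˢ ∩ Dᶜˢ).card = (U ∩ D).card := by rw [← Finset.compls_inter, Finset.card_compls]
  have expand : ∀ y : Finset α, ((if u y then (1:ℤ) else 0) - (if u yᶜ then (1:ℤ) else 0)) *
        ((if d yᶜ then (1:ℤ) else 0) - (if d y then (1:ℤ) else 0))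
      = (if u y then (1:ℤ) else 0) * (if d yᶜ then (1:ℤ) else 0) - (if u y then (1:ℤ) else 0) * (if d y then (1:ℤ) else 0)
        - (if u yᶜ then (1:ℤ) else 0) * (if d yᶜ then (1:ℤ) else 0) + (if u yᶜ then (1:ℤ) else 0) * (if d y then (1:ℤ) else 0) := by
    intro y; ring
  simp_rw [expand]
  rw [Finset.sum_add_distrib, Finset.sum_sub_distrib, Finset.sum_sub_distrib, e1, e2, e3, e4, c3, c4]
  have hK' : ((U ∩ D).card : ℤ) ≤ ((U ∩ Dᶜˢ).card : ℤ) := by exact_mod_cast hK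
  linarith

/-- SUMMATION SKELETON.  If `K y ≤ L y + L yᶜ` for every `y` and `Σ_y K y ≥ 0`, then `Σ_y L y ≥ 0`
(`2 Σ L = Σ_y (L y + L yᶜ)` by the complement involution). [this work] -/
theorem sum_nonneg_of_pair (L K : Finset α → ℤ) (hpair : ∀ y : Finset α, K y ≤ L y + L yᶜ)
    (hK : 0 ≤ ∑ y : Finset α, K y) : 0 ≤ ∑ y : Finset α, L y := by
  have hsym : ∑ y : Finset α, L yᶜ = ∑ y : Finset α, L y :=
    Function.Bijective.sum_comp (Function.Involutive.bijective (fun y : Finset α => compl_compl y)) L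
  have h2 : ∑ y : Finset α, K y ≤ ∑ y : Finset α, (L y + L yᶜ) := Finset.sum_le_sum (fun y _ => hpair y)
  rw [Finset.sum_add_distrib, hsym] at h2
  linarith

/-- **THEOREM LEVEL∞ (the level lemma for `s` root leaves, every `s`), from the pair lemma.**  Sixteen upper families of the
Boolean lattice `2^α` — memberships of the up-sets `a` (`aB aT aU aE` at the bowtie levels `B′, T′, τ′, β′`), `a′` (`p·`), `b` (`b·`),
`b′` (`q·`) — with `·B ⊆ ·T ∩ ·U` and `·E ⊆ ·T ∩ ·U`.  HYPOTHESIS `hpair`: the pair lemma (32 Booleans; memo §3, machine-certified).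
CONCLUSION: the level functional — crossed products (partner level read at the antipode `yᶜ`) plus the certificates `c_B` (routes `T(yᶜ)`),
`c_T` (routes `B(yᶜ) ∨ β(yᶜ)`), `c_new` (routes `B(yᶜ)`, members `τ(y)`) minus `c_old` (routes `β(yᶜ)`, members `τ(y)`) — is nonnegative.
[this work; memo §1–§2] -/
theorem level_cube_charge (aB aT aU aE pB pT pU pE bB bT bU bE qB qT qU qE : Finset (Finset α))
    (u_aB : IsUpperSet (aB : Set (Finset α)))
    (u_aT : IsUpperSet (aT : Set (Finset α)))
    (u_pB : IsUpperSet (pB : Set (Finset α)))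
    (u_pT : IsUpperSet (pT : Set (Finset α)))
    (u_bB : IsUpperSet (bB : Set (Finset α)))
    (u_bT : IsUpperSet (bT : Set (Finset α)))
    (u_qB : IsUpperSet (qB : Set (Finset α)))
    (u_qT : IsUpperSet (qT : Set (Finset α)))
    (i_aBT : aB ⊆ aT) (i_aBU : aB ⊆ aU) (i_aET : aE ⊆ aT) (i_aEU : aE ⊆ aU)
    (i_pBT : pB ⊆ pT) (i_pBU : pB ⊆ pU) (i_pET : pE ⊆ pT) (i_pEU : pE ⊆ pU)
    (i_bBT : bB ⊆ bT) (i_bBU : bB ⊆ bU) (i_bET : bE ⊆ bT) (i_bEU : bE ⊆ bU)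
    (i_qBT : qB ⊆ qT) (i_qBU : qB ⊆ qU) (i_qET : qE ⊆ qT) (i_qEU : qE ⊆ qU)
    (hpair : ∀ aT0 aU0 aB0 : Bool, (aB0 = true → aT0 = true) → (aB0 = true → aU0 = true) →
      ∀ aE0 : Bool, (aE0 = true → aT0 = true) → (aE0 = true → aU0 = true) →
      ∀ pT0 pU0 pB0 : Bool, (pB0 = true → pT0 = true) → (pB0 = true → pU0 = true) →
      ∀ pE0 : Bool, (pE0 = true → pT0 = true) → (pE0 = true → pU0 = true) →
      ∀ bT0 bU0 bB0 : Bool, (bB0 = true → bT0 = true) → (bB0 = true → bU0 = true) →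
      ∀ bE0 : Bool, (bE0 = true → bT0 = true) → (bE0 = true → bU0 = true) →
      ∀ qT0 qU0 qB0 : Bool, (qB0 = true → qT0 = true) → (qB0 = true → qU0 = true) →
      ∀ qE0 : Bool, (qE0 = true → qT0 = true) → (qE0 = true → qU0 = true) →
      ∀ aT1 aU1 aB1 : Bool, (aB1 = true → aT1 = true) → (aB1 = true → aU1 = true) →
      ∀ aE1 : Bool, (aE1 = true → aT1 = true) → (aE1 = true → aU1 = true) →
      ∀ pT1 pU1 pB1 : Bool, (pB1 = true → pT1 = true) → (pB1 = true → pU1 = true) →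
      ∀ pE1 : Bool, (pE1 = true → pT1 = true) → (pE1 = true → pU1 = true) →
      ∀ bT1 bU1 bB1 : Bool, (bB1 = true → bT1 = true) → (bB1 = true → bU1 = true) →
      ∀ bE1 : Bool, (bE1 = true → bT1 = true) → (bE1 = true → bU1 = true) →
      ∀ qT1 qU1 qB1 : Bool, (qB1 = true → qT1 = true) → (qB1 = true → qU1 = true) →
      ∀ qE1 : Bool, (qE1 = true → qT1 = true) → (qE1 = true → qU1 = true) →
      0 ≤ ((if aB0 then (1:ℤ) else 0) - (if pT1 then (1:ℤ) else 0)) * ((if bB0 then (1:ℤ) else 0) - (if qT1 then (1:ℤ) else 0)) + ((if aT0 then (1:ℤ) else 0) - (if pB1 then (1:ℤ) else 0)) * ((if bT0 then (1:ℤ) else 0) - (if qB1 then (1:ℤ) else 0))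
      + (if ((aT1 ∧ ¬ pB0 ∧ ¬ bB0 ∧ qT1) ∨ (¬ aB0 ∧ pT1 ∧ bT1 ∧ ¬ qB0)) then (1:ℤ) else 0)
      + (if (((aB1 ∨ aE1) ∧ ¬ pT0 ∧ ¬ bT0 ∧ (qB1 ∨ qE1)) ∨ (¬ aT0 ∧ (pB1 ∨ pE1) ∧ (bB1 ∨ bE1) ∧ ¬ qT0)) then (1:ℤ) else 0)
      + (if ((aB1 ∧ ¬ pU0 ∧ ¬ bU0 ∧ qB1) ∨ (¬ aU0 ∧ pB1 ∧ bB1 ∧ ¬ qU0)) then (1:ℤ) else 0)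
      - (if ((aE1 ∧ ¬ pU0 ∧ ¬ bU0 ∧ qE1) ∨ (¬ aU0 ∧ pE1 ∧ bE1 ∧ ¬ qU0)) then (1:ℤ) else 0)
      + (((if aB1 then (1:ℤ) else 0) - (if pT0 then (1:ℤ) else 0)) * ((if bB1 then (1:ℤ) else 0) - (if qT0 then (1:ℤ) else 0)) + ((if aT1 then (1:ℤ) else 0) - (if pB0 then (1:ℤ) else 0)) * ((if bT1 then (1:ℤ) else 0) - (if qB0 then (1:ℤ) else 0))
      + (if ((aT0 ∧ ¬ pB1 ∧ ¬ bB1 ∧ qT0) ∨ (¬ aB1 ∧ pT0 ∧ bT0 ∧ ¬ qB1)) then (1:ℤ) else 0)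
      + (if (((aB0 ∨ aE0) ∧ ¬ pT1 ∧ ¬ bT1 ∧ (qB0 ∨ qE0)) ∨ (¬ aT1 ∧ (pB0 ∨ pE0) ∧ (bB0 ∨ bE0) ∧ ¬ qT1)) then (1:ℤ) else 0)
      + (if ((aB0 ∧ ¬ pU1 ∧ ¬ bU1 ∧ qB0) ∨ (¬ aU1 ∧ pB0 ∧ bB0 ∧ ¬ qU1)) then (1:ℤ) else 0)
      - (if ((aE0 ∧ ¬ pU1 ∧ ¬ bU1 ∧ qE0) ∨ (¬ aU1 ∧ pE0 ∧ bE0 ∧ ¬ qU1)) then (1:ℤ) else 0))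
      - (((if (bB0 ∧ ¬ qB1) then (1:ℤ) else 0) - (if (bB1 ∧ ¬ qB0) then (1:ℤ) else 0)) * ((if (¬ aB1 ∧ pB0) then (1:ℤ) else 0) - (if (¬ aB0 ∧ pB1) then (1:ℤ) else 0))
      + ((if (qB0 ∧ ¬ bB1) then (1:ℤ) else 0) - (if (qB1 ∧ ¬ bB0) then (1:ℤ) else 0)) * ((if (¬ pB1 ∧ aB0) then (1:ℤ) else 0) - (if (¬ pB0 ∧ aB1) then (1:ℤ) else 0))
      + ((if (bT0 ∧ ¬ qT1) then (1:ℤ) else 0) - (if (bT1 ∧ ¬ qT0) then (1:ℤ) else 0)) * ((if (¬ aT1 ∧ pT0) then (1:ℤ) else 0) - (if (¬ aT0 ∧ pT1) then (1:ℤ) else 0))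
      + ((if (qT0 ∧ ¬ bT1) then (1:ℤ) else 0) - (if (qT1 ∧ ¬ bT0) then (1:ℤ) else 0)) * ((if (¬ pT1 ∧ aT0) then (1:ℤ) else 0) - (if (¬ pT0 ∧ aT1) then (1:ℤ) else 0)))) :
    0 ≤ ∑ y : Finset α, (((if y ∈ aB then (1:ℤ) else 0) - (if yᶜ ∈ pT then (1:ℤ) else 0)) * ((if y ∈ bB then (1:ℤ) else 0) - (if yᶜ ∈ qT then (1:ℤ) else 0)) + ((if y ∈ aT then (1:ℤ) else 0) - (if yᶜ ∈ pB then (1:ℤ) else 0)) * ((if y ∈ bT then (1:ℤ) else 0) - (if yᶜ ∈ qB then (1:ℤ) else 0))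
        + (if ((yᶜ ∈ aT ∧ y ∉ pB ∧ y ∉ bB ∧ yᶜ ∈ qT) ∨ (y ∉ aB ∧ yᶜ ∈ pT ∧ yᶜ ∈ bT ∧ y ∉ qB)) then (1:ℤ) else 0)
        + (if (((yᶜ ∈ aB ∨ yᶜ ∈ aE) ∧ y ∉ pT ∧ y ∉ bT ∧ (yᶜ ∈ qB ∨ yᶜ ∈ qE)) ∨ (y ∉ aT ∧ (yᶜ ∈ pB ∨ yᶜ ∈ pE) ∧ (yᶜ ∈ bB ∨ yᶜ ∈ bE) ∧ y ∉ qT)) then (1:ℤ) else 0)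
        + (if ((yᶜ ∈ aB ∧ y ∉ pU ∧ y ∉ bU ∧ yᶜ ∈ qB) ∨ (y ∉ aU ∧ yᶜ ∈ pB ∧ yᶜ ∈ bB ∧ y ∉ qU)) then (1:ℤ) else 0)
        - (if ((yᶜ ∈ aE ∧ y ∉ pU ∧ y ∉ bU ∧ yᶜ ∈ qE) ∨ (y ∉ aU ∧ yᶜ ∈ pE ∧ yᶜ ∈ bE ∧ y ∉ qU)) then (1:ℤ) else 0)) := by
  refine sum_nonneg_of_pair (fun y => ((if y ∈ aB then (1:ℤ) else 0) - (if yᶜ ∈ pT then (1:ℤ) else 0)) * ((if y ∈ bB then (1:ℤ) else 0) - (if yᶜ ∈ qT then (1:ℤ) else 0)) + ((if y ∈ aT then (1:ℤ) else 0) - (if yᶜ ∈ pB then (1:ℤ) else 0)) * ((if y ∈ bT then (1:ℤ) else 0) - (if yᶜ ∈ qB then (1:ℤ) else 0))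
        + (if ((yᶜ ∈ aT ∧ y ∉ pB ∧ y ∉ bB ∧ yᶜ ∈ qT) ∨ (y ∉ aB ∧ yᶜ ∈ pT ∧ yᶜ ∈ bT ∧ y ∉ qB)) then (1:ℤ) else 0)
        + (if (((yᶜ ∈ aB ∨ yᶜ ∈ aE) ∧ y ∉ pT ∧ y ∉ bT ∧ (yᶜ ∈ qB ∨ yᶜ ∈ qE)) ∨ (y ∉ aT ∧ (yᶜ ∈ pB ∨ yᶜ ∈ pE) ∧ (yᶜ ∈ bB ∨ yᶜ ∈ bE) ∧ y ∉ qT)) then (1:ℤ) else 0)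
        + (if ((yᶜ ∈ aB ∧ y ∉ pU ∧ y ∉ bU ∧ yᶜ ∈ qB) ∨ (y ∉ aU ∧ yᶜ ∈ pB ∧ yᶜ ∈ bB ∧ y ∉ qU)) then (1:ℤ) else 0)
        - (if ((yᶜ ∈ aE ∧ y ∉ pU ∧ y ∉ bU ∧ yᶜ ∈ qE) ∨ (y ∉ aU ∧ yᶜ ∈ pE ∧ yᶜ ∈ bE ∧ y ∉ qU)) then (1:ℤ) else 0)) (fun y => ((if (y ∈ bB ∧ yᶜ ∉ qB) then (1:ℤ) else 0) - (if (yᶜ ∈ bB ∧ y ∉ qB) then (1:ℤ) else 0)) * ((if (yᶜ ∉ aB ∧ y ∈ pB) then (1:ℤ) else 0) - (if (y ∉ aB ∧ yᶜ ∈ pB) then (1:ℤ) else 0))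
        + ((if (y ∈ qB ∧ yᶜ ∉ bB) then (1:ℤ) else 0) - (if (yᶜ ∈ qB ∧ y ∉ bB) then (1:ℤ) else 0)) * ((if (yᶜ ∉ pB ∧ y ∈ aB) then (1:ℤ) else 0) - (if (y ∉ pB ∧ yᶜ ∈ aB) then (1:ℤ) else 0))
        + ((if (y ∈ bT ∧ yᶜ ∉ qT) then (1:ℤ) else 0) - (if (yᶜ ∈ bT ∧ y ∉ qT) then (1:ℤ) else 0)) * ((if (yᶜ ∉ aT ∧ y ∈ pT) then (1:ℤ) else 0) - (if (y ∉ aT ∧ yᶜ ∈ pT) then (1:ℤ) else 0))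
        + ((if (y ∈ qT ∧ yᶜ ∉ bT) then (1:ℤ) else 0) - (if (yᶜ ∈ qT ∧ y ∉ bT) then (1:ℤ) else 0)) * ((if (yᶜ ∉ pT ∧ y ∈ aT) then (1:ℤ) else 0) - (if (y ∉ pT ∧ yᶜ ∈ aT) then (1:ℤ) else 0))) ?_ ?_
  · -- the pair lemma at (y, yᶜ)
    intro y
    have h := hpair (decide (y ∈ aT))
        (decide (y ∈ aU))
        (decide (y ∈ aB))
        (by simpa using fun h => i_aBT h)
        (by simpa using fun h => i_aBU h)
        (decide (y ∈ aE))
        (by simpa using fun h => i_aET h)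
        (by simpa using fun h => i_aEU h)
        (decide (y ∈ pT))
        (decide (y ∈ pU))
        (decide (y ∈ pB))
        (by simpa using fun h => i_pBT h)
        (by simpa using fun h => i_pBU h)
        (decide (y ∈ pE))
        (by simpa using fun h => i_pET h)
        (by simpa using fun h => i_pEU h)
        (decide (y ∈ bT))
        (decide (y ∈ bU))
        (decide (y ∈ bB))
        (by simpa using fun h => i_bBT h)
        (by simpa using fun h => i_bBU h)
        (decide (y ∈ bE))
        (by simpa using fun h => i_bET h)
        (by simpa using fun h => i_bEU h)
        (decide (y ∈ qT))
        (decide (y ∈ qU))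
        (decide (y ∈ qB))
        (by simpa using fun h => i_qBT h)
        (by simpa using fun h => i_qBU h)
        (decide (y ∈ qE))
        (by simpa using fun h => i_qET h)
        (by simpa using fun h => i_qEU h)
        (decide (yᶜ ∈ aT))
        (decide (yᶜ ∈ aU))
        (decide (yᶜ ∈ aB))
        (by simpa using fun h => i_aBT h)
        (by simpa using fun h => i_aBU h)
        (decide (yᶜ ∈ aE))
        (by simpa using fun h => i_aET h)
        (by simpa using fun h => i_aEU h)
        (decide (yᶜ ∈ pT))
        (decide (yᶜ ∈ pU))
        (decide (yᶜ ∈ pB))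
        (by simpa using fun h => i_pBT h)
        (by simpa using fun h => i_pBU h)
        (decide (yᶜ ∈ pE))
        (by simpa using fun h => i_pET h)
        (by simpa using fun h => i_pEU h)
        (decide (yᶜ ∈ bT))
        (decide (yᶜ ∈ bU))
        (decide (yᶜ ∈ bB))
        (by simpa using fun h => i_bBT h)
        (by simpa using fun h => i_bBU h)
        (decide (yᶜ ∈ bE))
        (by simpa using fun h => i_bET h)
        (by simpa using fun h => i_bEU h)
        (decide (yᶜ ∈ qT))
        (decide (yᶜ ∈ qU))
        (decide (yᶜ ∈ qB))
        (by simpa using fun h => i_qBT h)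
        (by simpa using fun h => i_qBU h)
        (decide (yᶜ ∈ qE))
        (by simpa using fun h => i_qET h)
        (by simpa using fun h => i_qEU h)
    simp only [decide_eq_true_eq, compl_compl] at h ⊢
    linarith
  · -- four Kleitman columns
    have m1 : ∀ (X Y : Finset (Finset α)), IsUpperSet (X : Set (Finset α)) → IsUpperSet (Y : Set (Finset α)) →
        ∀ y y' : Finset α, y ⊆ y' → (y ∈ X ∧ yᶜ ∉ Y) → (y' ∈ X ∧ y'ᶜ ∉ Y) := by
      intro X Y hX hY y y' hyy h
      exact ⟨hX hyy h.1, fun h' => h.2 (hY (compl_le_compl hyy) h')⟩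
    have m2 : ∀ (X Y : Finset (Finset α)), IsUpperSet (X : Set (Finset α)) → IsUpperSet (Y : Set (Finset α)) →
        ∀ y y' : Finset α, y ⊆ y' → (y' ∉ X ∧ y'ᶜ ∈ Y) → (y ∉ X ∧ yᶜ ∈ Y) := by
      intro X Y hX hY y y' hyy h
      exact ⟨fun h' => h.1 (hX hyy h'), hY (compl_le_compl hyy) h.2⟩
    have k1 := kleitman_column (fun y => y ∈ bB ∧ yᶜ ∉ qB) (fun y => y ∉ aB ∧ yᶜ ∈ pB) (m1 bB qB u_bB u_qB) (m2 aB pB u_aB u_pB)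
    have k2 := kleitman_column (fun y => y ∈ qB ∧ yᶜ ∉ bB) (fun y => y ∉ pB ∧ yᶜ ∈ aB) (m1 qB bB u_qB u_bB) (m2 pB aB u_pB u_aB)
    have k3 := kleitman_column (fun y => y ∈ bT ∧ yᶜ ∉ qT) (fun y => y ∉ aT ∧ yᶜ ∈ pT) (m1 bT qT u_bT u_qT) (m2 aT pT u_aT u_pT)
    have k4 := kleitman_column (fun y => y ∈ qT ∧ yᶜ ∉ bT) (fun y => y ∉ pT ∧ yᶜ ∈ aT) (m1 qT bT u_qT u_bT) (m2 pT aT u_pT u_aT)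
    simp only [compl_compl] at k1 k2 k3 k4
    rw [Finset.sum_add_distrib, Finset.sum_add_distrib, Finset.sum_add_distrib]
    linarith

end AntitheticLevelCube

end Summit.CriticalPhenomena.PercolationContinuityZ3.Theorems
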